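import Summits.HubbardSuperconductivity.HubbardSuperconductivity.Theorems.LiebTwinTwinOnsiteCondensationMajorantCore
import Summits.HubbardSuperconductivity.HubbardSuperconductivity.Theorems.LiebTwinTwinOnsiteCondensationMajorantFlipCap
import Summits.HubbardSuperconductivity.HubbardSuperconductivity.Theorems.LiebTwinTwinOnsiteCondensationMajorantFlipTransfer
import Summits.HubbardSuperconductivity.HubbardSuperconductivity.Theorems.LiebTwinTwinOnsiteCondensationTwinPairOrderIdentity
import HarnessLib

/-!
# Route `LiebTwin`, crux `TwinOnsiteCondensation` (stmt-HubbardSuperconductivity-15258), line `majorant`: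
# stub M2 `stub_spinFlipMajorant` — the spin-flip (transverse spin-density) majorant

For every side `L`, every `n`, every normalised `φ` of Lieb's `(n, n)` sector of the fermionic torus and every
contraction kernel `G` on `ℓ²(Λ_L)`, the spin-flip family `O'_G = Σ_{x,y} G x y • c†_{x↑} c_{y↓}` obeys

  `(Re⟨φ, O'_Gᴴ O'_G φ⟩)² ≤ ½ · L⁴ · F_s(φ̃)`,  `φ̃ = liebVec n |liebW n φ|`, `F_s(χ) = Re⟨χ, Δ_sᴴ Δ_s χ⟩`

(`Δ_s = pairField sWave L`), i.e. `SpinFlipMajorant` with `κ = 1/2`. Proof (all ingredients landed):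
* transfer (`SpinFlip.re_expect_spinFlip_eq_sum_norm_sq`): `Re⟨φ, O'ᴴO'φ⟩ = ‖Σ G x y • C_x W D_y‖²_F`,
  `W = liebW n φ`, `C_x = c†_x` (columns on `n`-subsets), `D_y = c†_y = c_yᵀ` (rows on `n`-subsets);
* polar split (`exists_mul_eq_conjTranspose_mul_eq_cfcAbs`): `W = S T`, `TᴴT = |W|`, `Tr((SSᴴ)²) = Tr(WᴴW) = 1`;
* block Cauchy–Schwarz (`frobenius_block_cauchy_schwarz`, here `sq_sum_norm_sq_channel_le`):
  `‖Σ G • C_x S T D_y‖⁴_F ≤ ‖Σ_x C_x SSᴴ C_xᴴ‖²_F · ‖Σ_y D_yᴴ |W| D_y‖²_F`;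
* creation-side cap (`SpinFlip.sum_norm_sq_sum_creation_conj_le`): first factor `≤ |Λ|² Tr((SSᴴ)²) = L⁴`;
* twin factor (`two_mul_sum_norm_sq_conj_eq_re_expect`, from the tree identity `expect_pairField_sWave_eq`):
  `2 ‖Σ_y D_yᴴ |W| D_y‖²_F = F_s(φ̃)`.
Lieb, PRL **62** (1989) 1201, proof of Theorem 1; Yang, PRL **63** (1989) 2144; Horn–Johnson, *Matrix Analysis*
(2012) §5.6, §7.3. No definition and no named fact is introduced.
-/

-- the mandated namespace `Summit.<Summit>.<Problem>.Theorems` repeats `HubbardSuperconductivity`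
-- (single-problem summit, D-0017), which the `dupNamespace` linter flags on every declaration
set_option linter.dupNamespace false

noncomputable section

namespace Summit.HubbardSuperconductivity.HubbardSuperconductivity.Theorems.LiebTwinMajorant

open Literature.MathematicalPhysics.QuantumLattice
open Matrix Finset
open scoped ComplexOrder MatrixOrder Matrix.Norms.L2Operator

namespace SpinFlip

/-! ### The block Cauchy–Schwarz inequality for a two-sided channel -/

section Channel

variable {a b ι Λ' : Type*} [Fintype a] [Fintype b] [Fintype ι] [Fintype Λ']

/-- **Block Cauchy–Schwarz for a two-sided channel.** For families `U_x : ℂ^ι → ℂ^a`, `D_y : ℂ^b → ℂ^ι`,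
square `S`, `T` on `ι` and a contraction kernel `G` on `ℂ^Λ`:
`(‖Σ_{x,y} G x y • U_x (S T) D_y‖²_F)² ≤ ‖Σ_x U_x (SSᴴ) U_xᴴ‖²_F · ‖Σ_y D_yᴴ (TᴴT) D_y‖²_F` — the landed
`frobenius_block_cauchy_schwarz` for the block row `P = [U_x S]_x`, the block column `Q = [T D_y]_y` and the
block kernel `K = 1 ⊗ G` (a contraction). Horn–Johnson, Matrix Analysis (2012) §5.6. [folklore] -/
theorem sq_sum_norm_sq_channel_le (U : Λ' → Matrix a ι ℂ) (D : Λ' → Matrix ι b ℂ) (S T : Matrix ι ι ℂ)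
    (G : Matrix Λ' Λ' ℂ) (hG : ∀ v : Λ' → ℂ, (star (G *ᵥ v) ⬝ᵥ (G *ᵥ v)).re ≤ (star v ⬝ᵥ v).re) :
    (∑ i : a, ∑ j : b, ‖(∑ x : Λ', ∑ y : Λ', G x y • (U x * (S * T) * D y)) i j‖ ^ 2) ^ 2 ≤
      (∑ i : a, ∑ i' : a, ‖(∑ x : Λ', U x * (S * Sᴴ) * (U x)ᴴ) i i'‖ ^ 2) *
        (∑ j : b, ∑ j' : b, ‖(∑ y : Λ', (D y)ᴴ * (Tᴴ * T) * D y) j j'‖ ^ 2) := by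
  classical
  -- the half-channels `A_x = U_x S`, `B_y = T D_y`
  set A : Λ' → Matrix a ι ℂ := fun x => U x * S with hA
  set B : Λ' → Matrix ι b ℂ := fun y => T * D y with hB
  have hAB : ∀ x y, U x * (S * T) * D y = A x * B y := fun x y => by
    simp only [hA, hB, Matrix.mul_assoc]
  have hAA : ∀ x, U x * (S * Sᴴ) * (U x)ᴴ = A x * (A x)ᴴ := fun x => by
    simp only [hA, conjTranspose_mul, Matrix.mul_assoc]
  have hBB : ∀ y, (D y)ᴴ * (Tᴴ * T) * D y = (B y)ᴴ * B y := fun y => by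
    simp only [hB, conjTranspose_mul, Matrix.mul_assoc]
  simp only [hAB, hAA, hBB]
  -- block row, block kernel, block column
  set P : Matrix a (ι × Λ') ℂ := Matrix.of fun i p => A p.2 i p.1 with hP
  set Q : Matrix (ι × Λ') b ℂ := Matrix.of fun p j => B p.2 p.1 j with hQ
  set K : Matrix (ι × Λ') (ι × Λ') ℂ := Matrix.of fun p q => if p.1 = q.1 then G p.2 q.2 else 0 with hK
  have hPKQ : P * K * Q = ∑ x : Λ', ∑ y : Λ', G x y • (A x * B y) := by
    ext i j
    simp only [Matrix.mul_apply, hP, hQ, hK, Matrix.of_apply, Fintype.sum_prod_type, Matrix.sum_apply,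
      Matrix.smul_apply, smul_eq_mul, mul_ite, mul_zero, Finset.sum_ite_irrel, Finset.sum_const_zero,
      Finset.sum_ite_eq', Finset.mem_univ, if_true, Finset.sum_mul, Finset.mul_sum]
    -- `Σ_β Σ_y Σ_x A_x[i,β] G[x,y] B_y[β,j] = Σ_x Σ_y Σ_β G[x,y] (A_x[i,β] B_y[β,j])`
    calc ∑ β : ι, ∑ y : Λ', ∑ x : Λ', A x i β * G x y * B y β j
        = ∑ β : ι, ∑ x : Λ', ∑ y : Λ', A x i β * G x y * B y β j :=
          Finset.sum_congr rfl fun β _ => Finset.sum_comm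
      _ = ∑ x : Λ', ∑ β : ι, ∑ y : Λ', A x i β * G x y * B y β j := Finset.sum_comm
      _ = ∑ x : Λ', ∑ y : Λ', ∑ β : ι, G x y * (A x i β * B y β j) := by
          refine Finset.sum_congr rfl fun x _ => ?_
          rw [Finset.sum_comm]
          exact Finset.sum_congr rfl fun y _ => Finset.sum_congr rfl fun β _ => by ring
  have hPP : P * Pᴴ = ∑ x : Λ', A x * (A x)ᴴ := by
    ext i i'
    simp only [Matrix.mul_apply, hP, conjTranspose_apply, Matrix.of_apply, Fintype.sum_prod_type,
      Matrix.sum_apply]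
    exact Finset.sum_comm
  have hQQ : Qᴴ * Q = ∑ y : Λ', (B y)ᴴ * B y := by
    ext j j'
    simp only [Matrix.mul_apply, hQ, conjTranspose_apply, Matrix.of_apply, Fintype.sum_prod_type,
      Matrix.sum_apply]
    exact Finset.sum_comm
  have h := frobenius_block_cauchy_schwarz P K Q (re_star_blockKernel_mulVec_le G hG)
  rw [hPKQ, hPP, hQQ] at h
  exact h

end Channel

/-! ### The twin factor -/

section Twin

variable {Λ : Type*} [LinearOrder Λ] [Fintype Λ]

/-- **The twin factor in trace form.** For a Hermitian `V` on `n`-subsets and `D_y = (creation y).submatrix val id`: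
`2 Σ_{j,j'} ‖(Σ_y D_yᴴ V D_y)_{jj'}‖² = Re (2 Σ_x Σ_y Tr(Vᴴ B_{yx} V B_{yx}ᵀ))`, `B_{yx} = configHop n y x` — the
right-hand side is the Lieb-coordinate form of `⟨liebVec n V, Δ_sᴴ Δ_s liebVec n V⟩` (tree: `expect_pairField_sWave_eq`).
Uses `D_y D_{y'}ᴴ = B_{yy'}` and cyclicity of the trace. Lieb, PRL 62 (1989) 1201; Yang, PRL 63 (1989) 2144. [folklore] -/
theorem two_mul_sum_norm_sq_conj_eq_re (n : ℕ) {V : Matrix (Config Λ n) (Config Λ n) ℂ} (hV : Vᴴ = V) :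
    2 * ∑ j : Finset Λ, ∑ j' : Finset Λ,
        ‖(∑ y : Λ, ((creation y).submatrix (Subtype.val : Config Λ n → Finset Λ) id)ᴴ * V *
          (creation y).submatrix (Subtype.val : Config Λ n → Finset Λ) id) j j'‖ ^ 2 =
      (2 * ∑ x : Λ, ∑ y : Λ, (Vᴴ * (configHop n y x * (V * (configHop n y x)ᵀ))).trace).re := by
  -- the hop matrices `D_y D_{y'}ᴴ = B_{yy'}`
  have hhop : ∀ y y' : Λ,
      (creation y).submatrix (Subtype.val : Config Λ n → Finset Λ) id *
          ((creation y').submatrix (Subtype.val : Config Λ n → Finset Λ) id)ᴴ = configHop n y y' := by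
    intro y y'
    rw [conjTranspose_submatrix, creation_conjTranspose, ← submatrix_mul _ _ _ id _ Function.bijective_id]
    rfl
  -- cyclicity: `Tr(XᴴVX · YᴴVY) = Tr(V (XYᴴ) V (YXᴴ))`
  have key : ∀ X Y : Matrix (Config Λ n) (Finset Λ) ℂ,
      (Xᴴ * V * X * (Yᴴ * V * Y)).trace = (V * (X * Yᴴ) * V * (Y * Xᴴ)).trace := by
    intro X Y
    rw [show Xᴴ * V * X * (Yᴴ * V * Y) = Xᴴ * (V * (X * Yᴴ) * V * Y) by simp only [Matrix.mul_assoc],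
      Matrix.trace_mul_comm]
    simp only [Matrix.mul_assoc]
  set QQ : Matrix (Finset Λ) (Finset Λ) ℂ := ∑ y : Λ,
    ((creation y).submatrix (Subtype.val : Config Λ n → Finset Λ) id)ᴴ * V *
      (creation y).submatrix (Subtype.val : Config Λ n → Finset Λ) id with hQQ
  have hQQh : QQᴴ = QQ := by
    simp only [hQQ, conjTranspose_sum, conjTranspose_mul, conjTranspose_conjTranspose, hV, Matrix.mul_assoc]
  -- `Tr(QQ²) = Σ_y Σ_y' Tr(V B_{y'y} V B_{yy'})`
  have htr : (QQ * QQ).trace = ∑ y : Λ, ∑ y' : Λ, (V * configHop n y' y * V * configHop n y y').trace := by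
    simp only [hQQ, Matrix.sum_mul, Matrix.mul_sum, Matrix.trace_sum, key, hhop]
  have h2 : (2 : ℂ) = ((2 : ℝ) : ℂ) := by norm_num
  rw [← re_trace_conjTranspose_mul_self QQ, hQQh, htr, hV, h2, Complex.re_ofReal_mul]
  simp only [LiebTwinTwin.configHop_transpose, Matrix.mul_assoc]

end Twin

section Torus

variable {L : ℕ} [NeZero L]

/-- **The twin factor is the on-site pair order (torus).** For a Hermitian `V` on the `n`-subsets of the torus,
`2 · Σ_{j,j'} ‖(Σ_y D_yᴴ V D_y)_{jj'}‖² = Re⟨liebVec n V, Δ_sᴴ Δ_s liebVec n V⟩`, `D_y = (creation y).submatrix val id`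
(`two_mul_sum_norm_sq_conj_eq_re` and the tree identity `expect_pairField_sWave_eq`).
Lieb, PRL 62 (1989) 1201; Yang, PRL 63 (1989) 2144. [folklore] -/
theorem two_mul_sum_norm_sq_conj_eq_re_expect (n : ℕ)
    {V : Matrix (Config (FermionTorus 2 L) n) (Config (FermionTorus 2 L) n) ℂ} (hV : Vᴴ = V) :
    2 * ∑ j : Finset (FermionTorus 2 L), ∑ j' : Finset (FermionTorus 2 L),
        ‖(∑ y : FermionTorus 2 L,
          ((creation y).submatrix (Subtype.val : Config (FermionTorus 2 L) n → Finset (FermionTorus 2 L)) id)ᴴ *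
            V * (creation y).submatrix (Subtype.val : Config (FermionTorus 2 L) n → Finset (FermionTorus 2 L)) id)
          j j'‖ ^ 2 =
      (expect ((pairField sWave L)ᴴ * pairField sWave L) (liebVec n V)).re := by
  rw [LiebTwinTwin.expect_pairField_sWave_eq (isInSector_liebVec n V), LiebThm1.liebW_liebVec]
  exact two_mul_sum_norm_sq_conj_eq_re n hV

end Torus

/-- Real bookkeeping of the assembly: `E = X`, `X² ≤ P·Q`, `P ≤ M`, `0 ≤ Q`, `2Q = F` give `E² ≤ ½·M·F`. [folklore] -/
theorem sq_le_half_mul_of {E X P Q F M : ℝ} (hE : E = X) (hX : X ^ 2 ≤ P * Q) (hP : P ≤ M) (hQ0 : 0 ≤ Q)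
    (hQ : 2 * Q = F) : E ^ 2 ≤ 1 / 2 * M * F := by
  subst hE
  rw [← hQ]
  nlinarith [mul_le_mul_of_nonneg_right hP hQ0]

end SpinFlip

open SpinFlip

/-- **Stub M2 — the spin-flip (transverse spin-density) majorant** (`SpinFlipMajorant` of line `majorant`, with
`κ = 1/2`): for every side `L`, every `n`, every normalised `φ` in Lieb's `(n, n)` sector of the torus and every
contraction kernel `G` on `ℓ²(Λ_L)`, `O'_G = Σ_{x,y} G x y • c†_{x↑} c_{y↓}` satisfies
`(Re⟨φ, O'_Gᴴ O'_G φ⟩)² ≤ ½ · L⁴ · Re⟨φ̃, Δ_sᴴ Δ_s φ̃⟩`, `φ̃ = liebVec n |liebW n φ|`: every transverse spin-flip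
channel of `φ` is dominated by the on-site pair order of its twin (transfer to Lieb coordinates, polar split
`W = ST`, block Cauchy–Schwarz, the creation-side cap `≤ L⁴`, and the twin pair-order identity).
[cite: LiebPRL1989, proof of Theorem 1] -/
theorem stub_spinFlipMajorant :
    ∃ κ : ℝ, 0 < κ ∧ ∀ (L : ℕ) [NeZero L] (n : ℕ) (φ : Fock (Orb (FermionTorus 2 L))),
      star φ ⬝ᵥ φ = 1 → IsInSector n n φ →
        ∀ G : Matrix (FermionTorus 2 L) (FermionTorus 2 L) ℂ,
          (∀ v : FermionTorus 2 L → ℂ, (star (G *ᵥ v) ⬝ᵥ (G *ᵥ v)).re ≤ (star v ⬝ᵥ v).re) →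
          (expect ((∑ x : FermionTorus 2 L, ∑ y : FermionTorus 2 L,
                G x y • (creation (orb x 0) * annihilation (orb y 1)))ᴴ *
              (∑ x : FermionTorus 2 L, ∑ y : FermionTorus 2 L,
                G x y • (creation (orb x 0) * annihilation (orb y 1)))) φ).re ^ 2 ≤
            κ * (L : ℝ) ^ 4 *
              (expect ((pairField sWave L)ᴴ * pairField sWave L)
                (liebVec n (CFC.abs (liebW n φ)))).re := by
  refine ⟨1 / 2, by norm_num, ?_⟩
  intro L _ n φ hφ1 hφ G hG
  -- polar split of the Lieb matrix `W = S T`, `TᴴT = |W|`, `Tr((SSᴴ)²) = Tr(WᴴW)`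
  obtain ⟨S, T, hST, hTT, htr⟩ := exists_mul_eq_conjTranspose_mul_eq_cfcAbs (liebW n φ)
  -- STEP T: `Re⟨φ, O'ᴴO'φ⟩ = ‖Σ G x y • C_x (S T) D_y‖²_F`
  have hT := re_expect_spinFlip_eq_sum_norm_sq hφ G
  rw [← hST] at hT
  -- block Cauchy–Schwarz
  have hCS := sq_sum_norm_sq_channel_le
    (fun x : FermionTorus 2 L => (creation x).submatrix id
      (Subtype.val : Config (FermionTorus 2 L) n → Finset (FermionTorus 2 L)))
    (fun y : FermionTorus 2 L => (creation y).submatrix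
      (Subtype.val : Config (FermionTorus 2 L) n → Finset (FermionTorus 2 L)) id) S T G hG
  -- the creation-side factor: `≤ |Λ|² Tr((SSᴴ)²) = L⁴ ⟨φ, φ⟩ = L⁴`
  have hcard : (Fintype.card (FermionTorus 2 L) : ℝ) = (L : ℝ) ^ 2 := by
    rw [show Fintype.card (FermionTorus 2 L) = L ^ 2 by
      simp [FermionTorus, Fintype.card_lex, Fintype.card_fin]]
    push_cast
    ring
  have hSS : ∑ k : Config (FermionTorus 2 L) n, ∑ k' : Config (FermionTorus 2 L) n, ‖(S * Sᴴ) k k'‖ ^ 2 = 1 := by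
    rw [← re_trace_conjTranspose_mul_self (S * Sᴴ),
      show (S * Sᴴ)ᴴ = S * Sᴴ by rw [conjTranspose_mul, conjTranspose_conjTranspose], htr,
      show ((liebW n φ)ᴴ * liebW n φ).trace = hsInner (liebW n φ) (liebW n φ) from rfl,
      LiebThm1.hsInner_liebW hφ, hφ1, Complex.one_re]
  have hP : ∑ i : Finset (FermionTorus 2 L), ∑ i' : Finset (FermionTorus 2 L),
      ‖(∑ x : FermionTorus 2 L, (creation x).submatrix id
          (Subtype.val : Config (FermionTorus 2 L) n → Finset (FermionTorus 2 L)) * (S * Sᴴ) *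
        ((creation x).submatrix id
          (Subtype.val : Config (FermionTorus 2 L) n → Finset (FermionTorus 2 L)))ᴴ) i i'‖ ^ 2 ≤
      (L : ℝ) ^ 4 := by
    refine (sum_norm_sq_sum_creation_conj_le n (S * Sᴴ)).trans_eq ?_
    rw [hSS, hcard]
    ring
  -- the twin factor: `2 ‖Σ_y D_yᴴ |W| D_y‖²_F = F_s(φ̃)`
  have hsa : (CFC.abs (liebW n φ))ᴴ = CFC.abs (liebW n φ) :=
    (CFC.abs_nonneg (liebW n φ)).isSelfAdjoint.star_eq
  have hQ := two_mul_sum_norm_sq_conj_eq_re_expect (L := L) n hsa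
  conv at hQ => lhs; rw [← hTT]
  -- assemble (elaborated without the expected type: keeps the unifier off the torus sums)
  have h := sq_le_half_mul_of hT hCS hP
    (Finset.sum_nonneg fun _ _ => Finset.sum_nonneg fun _ _ => sq_nonneg _) hQ
  exact h

end Summit.HubbardSuperconductivity.HubbardSuperconductivity.Theorems.LiebTwinMajorant

end
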